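import Summits.Ventures.GridStability.Models.DroopVoltageBox
import Summits.Ventures.GridStability.Models.NE39DroopQV

/-!
# GridStability/Models/NE39DroopQVVoltageBox — instance rider of model-3's invariant voltage box (#87 «G3.b-DROOP-VBOX-THM») on the `n = 10` construction «DROOPQV-NE39» (30 states)

Cell `gridfusion` (LADDER-GRIDFUSION, APEX LINE rung G3.b; seat gridfusion-model-8 (g0); DRAFT offered to model-3 g7 / lead g6 2026-08-27T11:5xZ —
model-4 11:53:36Z showed the weak-susceptance-dominance hypothesis FAILS on both WSCC9 droop+QV constructions (node 2), but it HOLDS at all ten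
nodes of `NE39.droopQV` (`Models/NE39DroopQV.lean`, p523381). This file discharges the hypotheses of `DroopMicrogrid.voltage_box_invariant`
(`Models/DroopVoltageBox.lean`, model-3 p528866, [cite: KunduEtAl2019, eqs. (4a)–(4c), (5b)]) on that instance by exact rational checks:
`τ_Q = 1/2 > 0`, `k_Q = 1/5 ≥ 0`, `b_i = v⁰_i + k_Q Q^set_i > 0` (via the ℚ-twin `QsetQ`), `Σ_{j≠i} |B_ij| ≤ −B_ii` (`G = 0`; margins
≥ 0.93 pu), and states the box: along every solution of the 30-state model on `[0, T]` whose voltages start in `[0, M]^10`, `M > max_i b_i`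
(`NE39.droopQV_vbox_M = 3` works: `max b_i ≈ 2.25`), the voltages stay in `[0, M]^10`. THREE COLUMNS. CERTIFIED (kernel): an invariance
statement about solutions of the MODEL `NE39.droopQV.toMicrogrid` — a box, not an attractor, no synchronisation or stability content.
MODELLED: MV-6N — SYNTHETIC/CONSTRUCTION census object (Kundu gains on the NE39 pre-fault lossless h12 graph, G = 0, no loads, set-points
defined). VALIDATED: nothing. No sentence of this file says a grid, a microgrid or a converter is stable.
-/

noncomputable section

open Real Matrix Finset Set

namespace Summit.Ventures.GridStability.Models

namespace NE39

/-- Weak susceptance dominance of the construction's `B` (exact, all ten nodes; `G = 0`), in kernel-friendly list form: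
`Σ_{j≠i} |B_ij| + B_ii ≤ 0`. [folklore] -/
theorem droopQV_dominanceQ : ∀ i : Fin 10,
    (((List.finRange 10).filter (· ≠ i)).map (fun j => |droopQV.B i j|)).sum ≤ -droopQV.B i i := by
  decide +kernel

/-- The voltage offsets `b_i = v⁰_i + k_Q Q^set_i` are positive (exact, via the ℚ-twin `QsetQ`). [folklore] -/
theorem droopQV_bQ_pos : ∀ i : Fin 10, 0 < droopQV.V i + droopQV.kQ i * droopQV.QsetQ i ∧
    droopQV.V i + droopQV.kQ i * droopQV.QsetQ i < 3 := by
  unfold DroopQVData.QsetQ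
  decide +kernel

/-- List sums over `finRange.filter (· ≠ i)` are `Finset` sums over `univ.erase i`. [folklore] -/
theorem list_sum_filter_ne (f : Fin 10 → ℚ) (i : Fin 10) :
    (((List.finRange 10).filter (· ≠ i)).map f).sum = ∑ j ∈ univ.erase i, f j := by
  rw [← List.sum_toFinset _ ((List.nodup_finRange _).filter _)]
  congr 1
  ext j
  simp [Finset.mem_erase, ne_comm]

/-- **Invariant voltage box for «DROOPQV-NE39» (30 states).** Along every solution of `NE39.droopQV.toMicrogrid` on `[0, T]` whose voltages
start in `[0, 3]^10` (pu), the voltages stay in `[0, 3]^10` on `[0, T]` — model-3's `voltage_box_invariant` with its four hypotheses discharged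
exactly on the typed instance. CERTIFIED (invariance statement about the MODEL); MODELLED: MV-6N — SYNTHETIC/CONSTRUCTION; no stability sentence.
[cite: KunduEtAl2019, eqs. (4a)–(4c)] -/
theorem droopQV_voltage_box {T : ℝ} {γ : ℝ → DroopMicrogrid.State 10} (h : droopQV.toMicrogrid.IsSolutionOn γ (Icc 0 T))
    (h0 : ∀ i, 0 ≤ (γ 0).2.2 i ∧ (γ 0).2.2 i ≤ 3) :
    ∀ t ∈ Icc 0 T, ∀ i, 0 ≤ (γ t).2.2 i ∧ (γ t).2.2 i ≤ 3 := by
  have hg := fun i => droopQV.toMicrogrid_gains i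
  refine droopQV.toMicrogrid.voltage_box_invariant (fun i => ?_) (fun i => ?_) (fun i => ?_) (fun i => ?_) (fun i => ?_) h h0
  · rw [(hg i).2.1]; norm_num [droopQV]
  · rw [(hg i).2.2.2.1]; norm_num [droopQV]
  · have hb := (droopQV_bQ_pos i).1
    rw [(hg i).2.2.2.1, droopQV.Qset_eq droopQV_circle i]
    change (0 : ℝ) < (droopQV.V i : ℝ) + (droopQV.kQ i : ℝ) * (droopQV.QsetQ i : ℝ)
    exact_mod_cast hb
  · have hd := droopQV_dominanceQ i
    rw [list_sum_filter_ne] at hd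
    have hG : ∀ j, droopQV.toMicrogrid.G i j = 0 := fun j => by
      change ((droopQV.G i j : ℚ) : ℝ) = 0
      simp [droopQV]
    simp only [hG, abs_zero, zero_add]
    change ∑ j ∈ univ.erase i, |((droopQV.B i j : ℚ) : ℝ)| ≤ -((droopQV.B i i : ℚ) : ℝ)
    have : (∑ j ∈ univ.erase i, |((droopQV.B i j : ℚ) : ℝ)|) = (((∑ j ∈ univ.erase i, |droopQV.B i j|) : ℚ) : ℝ) := by
      push_cast; rfl
    rw [this]
    exact_mod_cast hd
  · have hb := (droopQV_bQ_pos i).2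
    rw [(hg i).2.2.2.1, droopQV.Qset_eq droopQV_circle i]
    change (droopQV.V i : ℝ) + (droopQV.kQ i : ℝ) * (droopQV.QsetQ i : ℝ) < 3
    exact_mod_cast hb

end NE39

end Summit.Ventures.GridStability.Models

end
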